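import Summits.CriticalPhenomena.PercolationContinuityZ3.Theorems.PercNearOneGluingNoHeavyLowerTailCSHDefs
import HarnessLib

/-!
# The conditioned slack hierarchy `CSH.CSHHolds`: reduction to INDICATORS OF UP-SETS of edge clusters (layer cake)

Support file for the cruxes `PercNearOneGluing.AdditiveGluing` (stmt-CriticalPhenomena-4576) / `NoHeavyLowerTail`
(stmt-CriticalPhenomena-4575), lead-of-record prim-png-lead-4576 gen 14, written for the p205010 audit (checklist item (d):
"what class of functionals does the Lean hypothesis `CSHHolds` quantify over, and is it the class the exact censuses test?").
No definitions, no named facts, no sorries.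

`CSH.CSHHolds w x Y D o v` (file `…NoHeavyLowerTailCSHDefs`) says: `0 ≤ cshMargin w x Y D o v f` for EVERY monotone
`f : Set (Sym2 V) → ℝ` (a real functional of the open EDGE cluster of the owner `x`).  We prove

* `CSH.cshMargin_add / cshMargin_smul / cshMargin_const` — the margin is linear in `f` and vanishes on constants
  (`covD` is a denominator-free covariance; `cshMarg` is linear by `cshMarg_add / cshMarg_smul` of the Defs file);
* `CSH.layerCake_nonneg_of_upperSets` — on a finite preorder, a functional `Φ` that is additive, homogeneous and zero on
  constants is `≥ 0` on every monotone function as soon as it is `≥ 0` on the indicator of every up-set (layer-cake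
  decomposition `f = (min f)·1 + Σ_i δ_i·1_{U_i}`, `δ_i > 0`, `U_i` up-sets, by induction on the support of `f − min f`);
* `CSH.cshHolds_iff_upperSets` — **`CSHHolds w x Y D o v ↔ ∀ U : Set (Set (Sym2 V)), IsUpperSet U → 0 ≤ cshMargin w x Y D o v (U.indicator 1)`.**

So MEMO THEOREM 1 (`CSH.cshHolds`, p205010) is, hypothesis class for hypothesis class, the statement "the CSH margin of the
indicator of every up-closed family of edge sets is nonnegative" — exactly the class minimised over by the exact edge-lattice
censuses (ttrl `gen/CSH.md` §EDGE-LATTICE, `cshx/`), which until now rested on an informal layer-cake remark.  (Up-closed families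
of the sub-poset of REALISABLE clusters are the traces of up-sets of the full lattice — take the upper closure — and the margin only
reads `f` on realisable clusters, so the two census conventions agree.)
[cite: VandenbergHaggstromKahn2005, Thm. 1.3 (p. 6)] [cite: KozmaNitzan2024, Conj. 4 (p. 32)]
-/

noncomputable section

namespace Summit.CriticalPhenomena.PercolationContinuityZ3.Theorems.CSH

open MeasureTheory Set Literature.Probability.LatticeModels Literature.Probability.Percolation
open scoped Classical

/-! ### Layer cake on a finite preorder -/

/-- **Layer cake.**  On a finite preorder, let `Φ` be additive, homogeneous and zero on constant functions.  If `Φ (1_U) ≥ 0`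
for every up-set `U`, then `Φ f ≥ 0` for every monotone `f`.  (Write `f = (min f)·1 + Σ_i δ_i 1_{U_i}` with `δ_i > 0` and
up-sets `U_1 ⊋ U_2 ⊋ …`, the super-level sets of `f`.) [folklore] -/
theorem layerCake_nonneg_of_upperSets {α : Type*} [Finite α] [Preorder α] (Φ : (α → ℝ) → ℝ)
    (hadd : ∀ f g : α → ℝ, Φ (f + g) = Φ f + Φ g) (hsmul : ∀ (c : ℝ) (f : α → ℝ), Φ (c • f) = c * Φ f)
    (hconst : ∀ c : ℝ, Φ (fun _ => c) = 0)
    (hU : ∀ U : Set α, IsUpperSet U → 0 ≤ Φ (U.indicator 1)) (f : α → ℝ) (hf : Monotone f) : 0 ≤ Φ f := by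
  haveI : Fintype α := Fintype.ofFinite α
  -- nonnegative monotone functions, by induction on the size of the support
  have key : ∀ k : ℕ, ∀ g : α → ℝ, Monotone g → (∀ a, 0 ≤ g a) →
      (Finset.univ.filter (fun a => 0 < g a)).card ≤ k → 0 ≤ Φ g := by
    intro k
    induction k with
    | zero =>
      intro g hg hg0 hcard
      have hz : g = fun _ => (0 : ℝ) := by
        funext a
        have hna : ¬ 0 < g a := by
          intro h
          have hmem : a ∈ Finset.univ.filter (fun a => 0 < g a) := by simp [h]
          rw [Nat.le_zero, Finset.card_eq_zero] at hcard
          simp [hcard] at hmem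
        exact le_antisymm (not_lt.mp hna) (hg0 a)
      rw [hz, hconst]
    | succ k ih =>
      intro g hg hg0 hcard
      set S := Finset.univ.filter (fun a => 0 < g a) with hS
      rcases S.eq_empty_or_nonempty with hSe | hne
      · exact ih g hg hg0 (by rw [← hS, hSe, Finset.card_empty]; exact Nat.zero_le _)
      · -- the smallest positive value `δ` and the up-set `U = {g > 0}`
        obtain ⟨a₀, ha₀, hδa₀⟩ := Finset.exists_mem_eq_inf' hne g
        set δ := S.inf' hne g with hδ
        have hSmem : ∀ a, a ∈ S ↔ 0 < g a := fun a => by simp [hS]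
        have hδle : ∀ a, 0 < g a → δ ≤ g a := fun a ha => Finset.inf'_le _ ((hSmem a).2 ha)
        have hδpos : 0 < δ := by rw [hδa₀]; exact (hSmem a₀).1 ha₀
        set U : Set α := {a | 0 < g a} with hUdef
        have hUup : IsUpperSet U := fun a b hab ha => lt_of_lt_of_le ha (hg hab)
        set g' : α → ℝ := fun a => g a - δ * U.indicator 1 a with hg'
        have hg'U : ∀ a, 0 < g a → g' a = g a - δ := fun a ha => by
          simp only [hg', indicator_of_mem (show a ∈ U from ha), Pi.one_apply, mul_one]
        have hg'nU : ∀ a, ¬ 0 < g a → g' a = 0 := fun a ha => by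
          have ga0 : g a = 0 := le_antisymm (not_lt.mp ha) (hg0 a)
          simp only [hg', indicator_of_notMem (show a ∉ U from ha), mul_zero, sub_zero, ga0]
        have hg'0 : ∀ a, 0 ≤ g' a := fun a => by
          by_cases ha : 0 < g a
          · rw [hg'U a ha]; linarith [hδle a ha]
          · rw [hg'nU a ha]
        have hg'mono : Monotone g' := by
          intro a b hab
          by_cases ha : 0 < g a
          · have hb : 0 < g b := lt_of_lt_of_le ha (hg hab)
            rw [hg'U a ha, hg'U b hb]; linarith [hg hab]
          · rw [hg'nU a ha]; exact hg'0 b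
        -- the support of `g'` loses at least the minimiser `a₀`
        have hsub : Finset.univ.filter (fun a => 0 < g' a) ⊆ S.erase a₀ := by
          intro a ha
          rw [Finset.mem_filter] at ha
          rw [Finset.mem_erase]
          have hga : 0 < g a := by
            by_contra hna
            rw [hg'nU a hna] at ha
            exact lt_irrefl _ ha.2
          refine ⟨?_, (hSmem a).2 hga⟩
          rintro rfl
          rw [hg'U a hga, ← hδa₀] at ha
          exact lt_irrefl _ (by linarith [ha.2] : (0 : ℝ) < 0)
        have hcard' : (Finset.univ.filter (fun a => 0 < g' a)).card ≤ k := by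
          have h1 := Finset.card_le_card hsub
          rw [Finset.card_erase_of_mem ha₀] at h1
          omega
        have h1 := ih g' hg'mono hg'0 hcard'
        have h2 := hU U hUup
        have hdec : g = g' + δ • U.indicator 1 := by
          funext a; simp only [hg', Pi.add_apply, Pi.smul_apply, smul_eq_mul]; ring
        rw [hdec, hadd, hsmul]
        positivity
  -- general monotone `f`: subtract the minimum
  rcases isEmpty_or_nonempty α with hα | hα
  · have : f = fun _ => (0 : ℝ) := funext fun a => (IsEmpty.false a).elim
    rw [this, hconst]
  · set m := Finset.univ.inf' Finset.univ_nonempty f with hm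
    have hmle : ∀ a, m ≤ f a := fun a => Finset.inf'_le _ (Finset.mem_univ a)
    set g : α → ℝ := fun a => f a - m with hg
    have hdec : f = g + fun _ => m := by funext a; simp [hg]
    have hgmono : Monotone g := fun a b hab => by simp only [hg]; linarith [hf hab]
    have hg0 : ∀ a, 0 ≤ g a := fun a => by simp only [hg]; linarith [hmle a]
    rw [hdec, hadd, hconst, add_zero]
    exact key _ g hgmono hg0 le_rfl

/-- The indicator of an up-set is a monotone function. [folklore] -/
theorem monotone_indicator_one_of_isUpperSet {α : Type*} [Preorder α] (U : Set α) (hU : IsUpperSet U) :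
    Monotone (U.indicator (1 : α → ℝ)) := by
  intro a b hab
  by_cases ha : a ∈ U
  · simp only [indicator_of_mem ha, indicator_of_mem (hU hab ha), Pi.one_apply, le_refl]
  · rw [indicator_of_notMem ha]
    exact indicator_nonneg (fun _ _ => zero_le_one) b

/-! ### Linearity of the CSH margin in the functional -/

variable {V : Type*} [Fintype V]

/-- `covD` is additive in the functional. [folklore] -/
theorem covD_add (w : Sym2 V → unitInterval) (x : V) (Y : Set V) (f g : Set (Sym2 V) → ℝ) :
    covD w x Y (f + g) = covD w x Y f + covD w x Y g := by
  funext u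
  have hint : ∀ (k : BondConfig V → ℝ) (T : Set (BondConfig V)), IntegrableOn k T (prodBernoulli w) :=
    fun k T => (Integrable.of_finite).integrableOn
  simp only [covD, Pi.add_apply]
  rw [integral_add (hint _ _) (hint _ _), integral_add (hint _ _) (hint _ _)]
  ring

omit [Fintype V] in
/-- `covD` commutes with scalars. [folklore] -/
theorem covD_smul (w : Sym2 V → unitInterval) (x : V) (Y : Set V) (c : ℝ) (f : Set (Sym2 V) → ℝ) :
    covD w x Y (c • f) = c • covD w x Y f := by
  funext u
  simp only [covD, Pi.smul_apply, smul_eq_mul]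
  rw [integral_const_mul, integral_const_mul]
  ring

omit [Fintype V] in
/-- `covD` vanishes on constant functionals (a covariance with a constant). [folklore] -/
theorem covD_const (w : Sym2 V → unitInterval) (x : V) (Y : Set V) (c : ℝ) :
    covD w x Y (fun _ => c) = 0 := by
  funext u
  simp only [covD, Pi.zero_apply, setIntegral_const, smul_eq_mul]
  ring

/-- The CSH margin is additive in the functional. [folklore] -/
theorem cshMargin_add (w : Sym2 V → unitInterval) (x : V) (Y : Set V) (D : List V) (o v : V)
    (f g : Set (Sym2 V) → ℝ) :
    cshMargin w x Y D o v (f + g) = cshMargin w x Y D o v f + cshMargin w x Y D o v g := by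
  simp only [cshMargin, covD_add, cshMarg_add]

omit [Fintype V] in
/-- The CSH margin commutes with scalars. [folklore] -/
theorem cshMargin_smul (w : Sym2 V → unitInterval) (x : V) (Y : Set V) (D : List V) (o v : V)
    (c : ℝ) (f : Set (Sym2 V) → ℝ) :
    cshMargin w x Y D o v (c • f) = c * cshMargin w x Y D o v f := by
  simp only [cshMargin, covD_smul, cshMarg_smul]

omit [Fintype V] in
/-- The CSH margin of a constant functional is `0`. [folklore] -/
theorem cshMargin_const (w : Sym2 V → unitInterval) (x : V) (Y : Set V) (D : List V) (o v : V) (c : ℝ) :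
    cshMargin w x Y D o v (fun _ => c) = 0 := by
  simp only [cshMargin, covD_const]
  have h := cshMarg_smul (decoyList w (insert x Y) D) (obsConst w o v (insert x Y ∪ {d | d ∈ D})) o v 0 0
  rw [zero_mul, zero_smul] at h
  exact h

/-! ### `CSHHolds` ⇔ nonnegative margins of up-set indicators -/

omit [Fintype V] in
/-- One direction: under `CSHHolds`, the margin of the indicator of every up-closed family of edge sets is `≥ 0`
(indicators of up-sets are monotone). [folklore] -/
theorem cshMargin_indicator_nonneg_of_cshHolds (w : Sym2 V → unitInterval) (x : V) (Y : Set V) (D : List V) (o v : V)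
    (h : CSHHolds w x Y D o v) (U : Set (Set (Sym2 V))) (hU : IsUpperSet U) :
    0 ≤ cshMargin w x Y D o v (U.indicator 1) :=
  h _ (monotone_indicator_one_of_isUpperSet U hU)

/-- The other direction (layer cake): nonnegative margins of all up-set indicators give `CSHHolds`. [folklore] -/
theorem cshHolds_of_upperSets (w : Sym2 V → unitInterval) (x : V) (Y : Set V) (D : List V) (o v : V)
    (h : ∀ U : Set (Set (Sym2 V)), IsUpperSet U → 0 ≤ cshMargin w x Y D o v (U.indicator 1)) :
    CSHHolds w x Y D o v := fun f hf =>
  layerCake_nonneg_of_upperSets (cshMargin w x Y D o v) (cshMargin_add w x Y D o v) (cshMargin_smul w x Y D o v)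
    (cshMargin_const w x Y D o v) h f hf

/-- **`CSHHolds` is equivalent to the nonnegativity of the CSH margins of the indicators of all up-closed families of edge
sets** — the hypothesis class of MEMO THEOREM 1 (`CSH.cshHolds`) is exactly the class of the exact edge-lattice censuses. [folklore] -/
theorem cshHolds_iff_upperSets (w : Sym2 V → unitInterval) (x : V) (Y : Set V) (D : List V) (o v : V) :
    CSHHolds w x Y D o v ↔
      ∀ U : Set (Set (Sym2 V)), IsUpperSet U → 0 ≤ cshMargin w x Y D o v (U.indicator 1) :=
  ⟨fun h U hU => cshMargin_indicator_nonneg_of_cshHolds w x Y D o v h U hU, cshHolds_of_upperSets w x Y D o v⟩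

/-! ### The census convention: up-closed families of REALISABLE edge clusters

The exact census engines key a configuration `ω` by the realisable open edge cluster `C_x(ω) = openEdgeCluster ω x` and minimise
the margin over the up-closed families of the finite poset `R = {C_x(ω) : ω}` of realisable clusters.  The margin reads `f` only
through `f (C_x ω)`, so this is the same minimum as over up-sets of the full lattice `Set (Sym2 V)`: an `R`-up-closed family
`U ⊆ R` is the trace on `R` of its upper closure, and an up-set of the full lattice traces to an `R`-up-closed family. -/

omit [Fintype V] in
/-- The CSH margin depends on the functional only through its values on realisable edge clusters of the owner. [folklore] -/
theorem cshMargin_congr_cluster (w : Sym2 V → unitInterval) (x : V) (Y : Set V) (D : List V) (o v : V)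
    {f g : Set (Sym2 V) → ℝ} (h : ∀ ω : BondConfig V, f (openEdgeCluster ω x) = g (openEdgeCluster ω x)) :
    cshMargin w x Y D o v f = cshMargin w x Y D o v g := by
  have hcov : covD w x Y f = covD w x Y g := by
    funext u; simp only [covD, h]
  simp only [cshMargin, hcov]

/-- **`CSHHolds` ⇔ nonnegative margins of the indicators of all up-closed families of REALISABLE edge clusters of the owner**
(the class key / poset convention of the exact edge-lattice censuses): `U ⊆ R := {openEdgeCluster ω x : ω}` and
`C ∈ U, C ⊆ openEdgeCluster ω x ⟹ openEdgeCluster ω x ∈ U`. [folklore] -/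
theorem cshHolds_iff_realisable_upperSets (w : Sym2 V → unitInterval) (x : V) (Y : Set V) (D : List V) (o v : V) :
    CSHHolds w x Y D o v ↔
      ∀ U : Set (Set (Sym2 V)), U ⊆ Set.range (fun ω : BondConfig V => openEdgeCluster ω x) →
        (∀ C ∈ U, ∀ ω : BondConfig V, C ⊆ openEdgeCluster ω x → openEdgeCluster ω x ∈ U) →
          0 ≤ cshMargin w x Y D o v (U.indicator 1) := by
  rw [cshHolds_iff_upperSets]
  constructor
  · intro h U _ hup
    -- replace `U` by its upper closure in the full lattice: same values on realisable clusters
    set U' : Set (Set (Sym2 V)) := {C | ∃ C₀ ∈ U, C₀ ⊆ C} with hU'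
    have hU'up : IsUpperSet U' := by
      rintro C C' hCC' ⟨C₀, hC₀, hC₀C⟩
      exact ⟨C₀, hC₀, hC₀C.trans hCC'⟩
    have hagree : ∀ ω : BondConfig V, U.indicator (1 : Set (Sym2 V) → ℝ) (openEdgeCluster ω x) =
        U'.indicator (1 : Set (Sym2 V) → ℝ) (openEdgeCluster ω x) := by
      intro ω
      by_cases hω : openEdgeCluster ω x ∈ U
      · have hω' : openEdgeCluster ω x ∈ U' := ⟨_, hω, subset_rfl⟩
        rw [indicator_of_mem hω, indicator_of_mem hω']
      · have hω' : openEdgeCluster ω x ∉ U' := by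
          rintro ⟨C₀, hC₀, hC₀C⟩
          exact hω (hup C₀ hC₀ ω hC₀C)
        rw [indicator_of_notMem hω, indicator_of_notMem hω']
    rw [cshMargin_congr_cluster w x Y D o v hagree]
    exact h U' hU'up
  · intro h U hU
    -- trace the up-set `U` on the realisable clusters
    set U' : Set (Set (Sym2 V)) := U ∩ Set.range (fun ω : BondConfig V => openEdgeCluster ω x) with hU'
    have hsub : U' ⊆ Set.range (fun ω : BondConfig V => openEdgeCluster ω x) := inter_subset_right
    have hup : ∀ C ∈ U', ∀ ω : BondConfig V, C ⊆ openEdgeCluster ω x → openEdgeCluster ω x ∈ U' :=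
      fun C hC ω hCω => ⟨hU hCω hC.1, ⟨ω, rfl⟩⟩
    have hagree : ∀ ω : BondConfig V, U.indicator (1 : Set (Sym2 V) → ℝ) (openEdgeCluster ω x) =
        U'.indicator (1 : Set (Sym2 V) → ℝ) (openEdgeCluster ω x) := by
      intro ω
      by_cases hω : openEdgeCluster ω x ∈ U
      · have hω' : openEdgeCluster ω x ∈ U' := ⟨hω, ⟨ω, rfl⟩⟩
        rw [indicator_of_mem hω, indicator_of_mem hω']
      · have hω' : openEdgeCluster ω x ∉ U' := fun h' => hω h'.1
        rw [indicator_of_notMem hω, indicator_of_notMem hω']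
    rw [cshMargin_congr_cluster w x Y D o v hagree]
    exact h U' hsub hup

end Summit.CriticalPhenomena.PercolationContinuityZ3.Theorems.CSH
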